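import Summits.QuantumFields.YangMills.Theorems.ColdStartUniversalityLatticeLangevinLatitudeODE
import Literature.MathematicalPhysics.QuantumFieldTheory.SU2CharacterConvolution
import Literature.MathematicalPhysics.QuantumFieldTheory.ContinuumLimitsYM2Haar
import Literature.MathematicalPhysics.QuantumLattice.GaugeGroups
import Mathlib.Analysis.CStarAlgebra.Matrix
import HarnessLib

/-!
# Route `ColdStartUniversality`, crux K_A1 `UniformColdStartMixing` (stmt-QuantumFields-24809), rung `stub_fixedCutoffMixing`:
# the heat kernel of `SU(2)` as a character series, and its Haar pairing with translated characters

Helper file (seat `ym-line-csu-p1`, g7).  In the normalisation of `latticeLangevinDynamics` at `β' = 0` (Brownian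
motion on `SU(2)` with generator `½ Δ_{S³}`, eigenvalue `-n(n+2)/2` on the spin-`n/2` block) the heat kernel with
respect to the Haar probability measure is the class function

  `h_t(U) = Σ_{n ≥ 0} (n+1) e^{-n(n+2)t/2} χ_n(U)`,   `χ_n(U) = U_n(Re tr U / 2)` (`su2Char`),

absolutely convergent for `t > 0`.  This file proves what the identification of the law of the `β' = 0` SZZ dynamics
needs: `h_t ≥ 1/2` for `t ≥ 2` (`half_le_heatKernelSU2`), continuity, and — from the tree's character convolution
identity `∫ χ_m(V) χ_n(V⁻¹U) dV = δ_{mn} χ_n(U)/(n+1)` (`SU2CharacterConvolution`) — the pairing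
`∫ χ_m(V g⁻¹) h_t(V z⁻¹) dV = e^{-m(m+2)t/2} χ_m(z g⁻¹)` (`integral_su2Char_mul_heatKernelSU2`), which matches the
closed-form latitude expectations `integral_prod_gegenbauer_latitude` (`χ_m(y g⁻¹) = U_m(⟨ρ g, ρ y⟩)`,
`su2Char_mul_inv_eq_gegenbauerSum`).  The series is written inline (no definition).  No sorry.  RECORD-rung R3
plumbing; nothing here bears on the mass gap.
-/

set_option autoImplicit false

noncomputable section

namespace Summit.QuantumFields.YangMills.Theorems.ColdStartUniversality

open MeasureTheory Finset Filter
open scoped BigOperators Topology Matrix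
open Literature.MathematicalPhysics.QuantumFieldTheory
open Literature.MathematicalPhysics.QuantumFieldTheory.Tomboulis2007 (su2Char)
open Literature.MathematicalPhysics.QuantumLattice (fundamentalRep)
open Literature.Analysis.SpecialFunctions (gegenbauerSum gegenbauerSum_rec gegenbauerSum_one gegenbauerSum_at_one_rec
  abs_gegenbauerSum_le_gegenbauerSum_one)

/-! ### Chebyshev `U_n` = Gegenbauer `C_n^{(1)}`; characters -/

/-- **`C_n^{(1)} = U_n`**: the Gegenbauer sum at `a = 1` is the Chebyshev polynomial of the second kind (same recurrence
`P_{n+2} = 2 s P_{n+1} - P_n`, same initial values). [folklore] -/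
theorem gegenbauerSum_one_eq_chebyshevU (n : ℕ) (s : ℝ) :
    gegenbauerSum 1 n s = (Polynomial.Chebyshev.U ℝ (n : ℤ)).eval s := by
  induction n using Nat.strong_induction_on with
  | _ n ih =>
    rcases n with _ | n
    · simp
    rcases n with _ | n
    · rw [gegenbauerSum_one]; simp
    · have hrec := gegenbauerSum_rec 1 n s
      have h1 := ih n (by omega)
      have h2 := ih (n + 1) (by omega)
      have hne : ((n : ℝ) + 2) ≠ 0 := by positivity
      have hC : gegenbauerSum 1 (n + 2) s = 2 * s * gegenbauerSum 1 (n + 1) s - gegenbauerSum 1 n s := by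
        have : ((n : ℝ) + 2) * gegenbauerSum 1 (n + 2) s =
            ((n : ℝ) + 2) * (2 * s * gegenbauerSum 1 (n + 1) s - gegenbauerSum 1 n s) := by
          rw [hrec]; ring
        exact mul_left_cancel₀ hne this
      rw [hC, h1, h2]
      have hU := Polynomial.Chebyshev.U_add_two ℝ (n : ℤ)
      have hcast : ((n + 2 : ℕ) : ℤ) = (n : ℤ) + 2 := by push_cast; ring
      rw [hcast, hU]
      push_cast
      simp

/-- `U_n(1) = n + 1` for the Gegenbauer sum at `a = 1`. [folklore] -/
theorem gegenbauerSum_one_at_one (n : ℕ) : gegenbauerSum 1 n 1 = (n : ℝ) + 1 := by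
  induction n with
  | zero => simp
  | succ n ih =>
    have h := gegenbauerSum_at_one_rec 1 n
    rw [ih] at h
    have hne : ((n : ℝ) + 1) ≠ 0 := by positivity
    have : ((n : ℝ) + 1) * gegenbauerSum 1 (n + 1) 1 = ((n : ℝ) + 1) * ((n : ℝ) + 1 + 1) := by rw [h]; ring
    have h2 := mul_left_cancel₀ hne this
    rw [h2]; push_cast; ring

/-- `|U_n(s)| ≤ n + 1` on `[-1, 1]`. [folklore] -/
theorem abs_gegenbauerSum_one_le (n : ℕ) {s : ℝ} (hs : |s| ≤ 1) : |gegenbauerSum 1 n s| ≤ (n : ℝ) + 1 := by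
  rw [← gegenbauerSum_one_at_one]
  exact abs_gegenbauerSum_le_gegenbauerSum_one (by norm_num) n hs

/-- `|Re tr U / 2| ≤ 1` for `U ∈ SU(2)`. [folklore] -/
theorem abs_re_trace_div_two_le (U : Matrix.specialUnitaryGroup (Fin 2) ℂ) :
    abs (((U : Matrix (Fin 2) (Fin 2) ℂ).trace.re) / 2) ≤ 1 := by
  have hU : (U : Matrix (Fin 2) (Fin 2) ℂ) ∈ Matrix.unitaryGroup (Fin 2) ℂ :=
    Matrix.specialUnitaryGroup_le_unitaryGroup U.2
  have h0 := (Complex.abs_re_le_norm _).trans (entry_norm_bound_of_unitary hU 0 0)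
  have h1 := (Complex.abs_re_le_norm _).trans (entry_norm_bound_of_unitary hU 1 1)
  have htr : ((U : Matrix (Fin 2) (Fin 2) ℂ).trace.re) =
      ((U : Matrix (Fin 2) (Fin 2) ℂ) 0 0).re + ((U : Matrix (Fin 2) (Fin 2) ℂ) 1 1).re := by
    rw [Matrix.trace_fin_two, Complex.add_re]
  rw [htr, abs_le]
  rw [abs_le] at h0 h1
  constructor <;> linarith [h0.1, h0.2, h1.1, h1.2]

/-- `χ_n(U) = U_n(Re tr U / 2)` as a Gegenbauer sum. [folklore] -/
theorem su2Char_eq_gegenbauerSum (n : ℕ) (U : Matrix.specialUnitaryGroup (Fin 2) ℂ) :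
    su2Char n U = gegenbauerSum 1 n (((U : Matrix (Fin 2) (Fin 2) ℂ)).trace.re / 2) := by
  rw [su2Char, gegenbauerSum_one_eq_chebyshevU]

/-- **`|χ_n| ≤ n + 1`.** [folklore] -/
theorem abs_su2Char_le' (n : ℕ) (U : Matrix.specialUnitaryGroup (Fin 2) ℂ) : |su2Char n U| ≤ (n : ℝ) + 1 := by
  rw [su2Char_eq_gegenbauerSum]
  exact abs_gegenbauerSum_one_le n (abs_re_trace_div_two_le U)

/-- `χ_0 = 1`. [folklore] -/
theorem su2Char_zero_apply (U : Matrix.specialUnitaryGroup (Fin 2) ℂ) : su2Char 0 U = 1 := by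
  rw [su2Char_eq_gegenbauerSum, Literature.Analysis.SpecialFunctions.gegenbauerSum_zero]

/-- `χ_n` is continuous. [folklore] -/
theorem continuous_su2Char_apply (n : ℕ) : Continuous (su2Char n : Matrix.specialUnitaryGroup (Fin 2) ℂ → ℝ) := by
  have h : (su2Char n : Matrix.specialUnitaryGroup (Fin 2) ℂ → ℝ) =
      fun U : Matrix.specialUnitaryGroup (Fin 2) ℂ => gegenbauerSum 1 n (((U : Matrix (Fin 2) (Fin 2) ℂ)).trace.re / 2) :=
    funext (su2Char_eq_gegenbauerSum n)
  rw [h]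
  exact (Literature.Analysis.SpecialFunctions.continuous_gegenbauerSum 1 n).comp
    ((Complex.continuous_re.comp (continuous_subtype_val.matrix_trace)).div_const _)

/-- `χ_n` is a class function: `χ_n(U V) = χ_n(V U)`. [folklore] -/
theorem su2Char_mul_comm (n : ℕ) (U V : Matrix.specialUnitaryGroup (Fin 2) ℂ) : su2Char n (U * V) = su2Char n (V * U) := by
  have h1 : ((U * V : Matrix.specialUnitaryGroup (Fin 2) ℂ) : Matrix (Fin 2) (Fin 2) ℂ) =
      (U : Matrix (Fin 2) (Fin 2) ℂ) * (V : Matrix (Fin 2) (Fin 2) ℂ) := rfl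
  have h2 : ((V * U : Matrix.specialUnitaryGroup (Fin 2) ℂ) : Matrix (Fin 2) (Fin 2) ℂ) =
      (V : Matrix (Fin 2) (Fin 2) ℂ) * (U : Matrix (Fin 2) (Fin 2) ℂ) := rfl
  rw [su2Char, su2Char, h1, h2, Matrix.trace_mul_comm]

/-- `χ_n(U⁻¹) = χ_n(U)` (the trace of `U⁻¹ = Uᴴ` is the conjugate of `tr U`). [folklore] -/
theorem su2Char_inv (n : ℕ) (U : Matrix.specialUnitaryGroup (Fin 2) ℂ) : su2Char n U⁻¹ = su2Char n U := by
  have h : ((U⁻¹ : Matrix.specialUnitaryGroup (Fin 2) ℂ) : Matrix (Fin 2) (Fin 2) ℂ) = star (U : Matrix (Fin 2) (Fin 2) ℂ) :=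
    rfl
  have htr : ((U⁻¹ : Matrix.specialUnitaryGroup (Fin 2) ℂ) : Matrix (Fin 2) (Fin 2) ℂ).trace.re =
      ((U : Matrix (Fin 2) (Fin 2) ℂ)).trace.re := by
    rw [h, Matrix.star_eq_conjTranspose, Matrix.trace_conjTranspose, Complex.star_def, Complex.conj_re]
  rw [su2Char, su2Char, htr]

/-- **The latitude in character language**: `U_m(⟨ρ g, ρ y⟩) = χ_m(y g⁻¹)`, where `⟨X, Y⟩ = ½ Re tr(X Yᴴ)`. [folklore] -/
theorem su2Char_mul_inv_eq_gegenbauerSum (m : ℕ) (g y : Matrix.specialUnitaryGroup (Fin 2) ℂ) :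
    su2Char m (y * g⁻¹) = gegenbauerSum 1 m (hsForm 2 (fundamentalRep (Fin 2) g) (fundamentalRep (Fin 2) y) / 2) := by
  have hcoe : ((y * g⁻¹ : Matrix.specialUnitaryGroup (Fin 2) ℂ) : Matrix (Fin 2) (Fin 2) ℂ) =
      (y : Matrix (Fin 2) (Fin 2) ℂ) * (g : Matrix (Fin 2) (Fin 2) ℂ)ᴴ := rfl
  have htr : ((y * g⁻¹ : Matrix.specialUnitaryGroup (Fin 2) ℂ) : Matrix (Fin 2) (Fin 2) ℂ).trace.re =
      hsForm 2 (fundamentalRep (Fin 2) g) (fundamentalRep (Fin 2) y) := by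
    rw [hsForm_apply, hcoe]
    -- `Re tr(y gᴴ) = Re tr((g yᴴ)ᴴ) = Re conj tr(g yᴴ) = Re tr(g yᴴ)`
    have h : ((y : Matrix (Fin 2) (Fin 2) ℂ) * (g : Matrix (Fin 2) (Fin 2) ℂ)ᴴ) =
        ((fundamentalRep (Fin 2) g : Matrix (Fin 2) (Fin 2) ℂ) * (fundamentalRep (Fin 2) y : Matrix (Fin 2) (Fin 2) ℂ)ᴴ)ᴴ := by
      rw [Matrix.conjTranspose_mul, Matrix.conjTranspose_conjTranspose]; rfl
    rw [h, Matrix.trace_conjTranspose, Complex.star_def, Complex.conj_re]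
  rw [su2Char_eq_gegenbauerSum, htr]

/-! ### The heat kernel series -/

/-- Summability of the majorant `Σ (n+1)² e^{-n(n+2)t/2}` for `t > 0`. [folklore] -/
theorem summable_heatKernelSU2_majorant {t : ℝ} (ht : 0 < t) :
    Summable fun n : ℕ => ((n : ℝ) + 1) ^ 2 * Real.exp (-((n : ℝ) * ((n : ℝ) + 2) / 2) * t) := by
  -- compare with `(n+1)² e^{-t n}` : `n(n+2)/2 ≥ n`
  have h1 : Summable fun n : ℕ => ((n : ℝ) + 1) ^ 2 * Real.exp (-t * n) := by
    have ha := Real.summable_pow_mul_exp_neg_nat_mul 2 ht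
    have hb := Real.summable_pow_mul_exp_neg_nat_mul 1 ht
    have hc := Real.summable_pow_mul_exp_neg_nat_mul 0 ht
    have := (ha.add (hb.mul_left 2)).add hc
    refine this.congr fun n => ?_
    simp only [pow_one, pow_zero, one_mul]; ring
  refine Summable.of_nonneg_of_le (fun n => by positivity) (fun n => ?_) h1
  refine mul_le_mul_of_nonneg_left (Real.exp_le_exp.2 ?_) (by positivity)
  have hn : (0 : ℝ) ≤ n := n.cast_nonneg
  have h2 : 0 ≤ t * n * n := by positivity
  nlinarith [h2]

/-- The terms of the heat kernel series are dominated by the majorant. [folklore] -/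
theorem norm_heatKernelSU2_term_le (t : ℝ) (n : ℕ) (U : Matrix.specialUnitaryGroup (Fin 2) ℂ) :
    ‖((n : ℝ) + 1) * Real.exp (-((n : ℝ) * ((n : ℝ) + 2) / 2) * t) * su2Char n U‖ ≤
      ((n : ℝ) + 1) ^ 2 * Real.exp (-((n : ℝ) * ((n : ℝ) + 2) / 2) * t) := by
  rw [Real.norm_eq_abs, abs_mul, abs_mul, abs_of_nonneg (by positivity : (0:ℝ) ≤ (n : ℝ) + 1),
    abs_of_nonneg (Real.exp_pos _).le, sq]
  calc ((n : ℝ) + 1) * Real.exp (-((n : ℝ) * ((n : ℝ) + 2) / 2) * t) * |su2Char n U|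
      ≤ ((n : ℝ) + 1) * Real.exp (-((n : ℝ) * ((n : ℝ) + 2) / 2) * t) * ((n : ℝ) + 1) :=
        mul_le_mul_of_nonneg_left (abs_su2Char_le' n U) (by positivity)
    _ = ((n : ℝ) + 1) * ((n : ℝ) + 1) * Real.exp (-((n : ℝ) * ((n : ℝ) + 2) / 2) * t) := by ring

/-- **The heat kernel series of `SU(2)` converges absolutely** for `t > 0`. [folklore] -/
theorem summable_heatKernelSU2 {t : ℝ} (ht : 0 < t) (U : Matrix.specialUnitaryGroup (Fin 2) ℂ) :
    Summable fun n : ℕ => ((n : ℝ) + 1) * Real.exp (-((n : ℝ) * ((n : ℝ) + 2) / 2) * t) * su2Char n U :=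
  Summable.of_norm_bounded (summable_heatKernelSU2_majorant ht) (fun n => norm_heatKernelSU2_term_le t n U)

/-- The heat kernel series is continuous on `SU(2)`. [folklore] -/
theorem continuous_heatKernelSU2 {t : ℝ} (ht : 0 < t) :
    Continuous fun U : Matrix.specialUnitaryGroup (Fin 2) ℂ =>
      ∑' n : ℕ, ((n : ℝ) + 1) * Real.exp (-((n : ℝ) * ((n : ℝ) + 2) / 2) * t) * su2Char n U :=
  continuous_tsum (fun n => continuous_const.mul (continuous_su2Char_apply n)) (summable_heatKernelSU2_majorant ht)
    (fun n U => norm_heatKernelSU2_term_le t n U)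

/-- The tail of the majorant is at most `1/2` for `t ≥ 2`: `Σ_{n ≥ 1} (n+1)² e^{-n(n+2)t/2} ≤ Σ_{n ≥ 1} (4 e^{-3})^n ≤ 1/2`.
[folklore] -/
theorem tsum_heatKernelSU2_majorant_tail_le {t : ℝ} (ht : 2 ≤ t) :
    ∑' n : ℕ, ((n + 1 : ℕ) + 1 : ℝ) ^ 2 * Real.exp (-(((n + 1 : ℕ) : ℝ) * (((n + 1 : ℕ) : ℝ) + 2) / 2) * t) ≤ 1 / 2 := by
  -- `q = 4 e^{-3} ≤ 1/5`
  set q : ℝ := 4 * Real.exp (-3) with hq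
  have hq0 : 0 ≤ q := by positivity
  have he3 : (16 : ℝ) ≤ Real.exp 3 := by
    have h27 : (2.7 : ℝ) ≤ Real.exp 1 := by linarith [Real.exp_one_gt_d9]
    have h3 : Real.exp 3 = Real.exp 1 ^ 3 := by rw [← Real.exp_nat_mul]; norm_num
    rw [h3]
    have hp := pow_le_pow_left₀ (by norm_num : (0:ℝ) ≤ 2.7) h27 3
    nlinarith [hp]
  have hq1 : q ≤ 1 / 4 := by
    rw [hq, Real.exp_neg]
    rw [mul_inv_le_iff₀ (Real.exp_pos 3)]
    linarith
  have hterm : ∀ n : ℕ, ((n + 1 : ℕ) + 1 : ℝ) ^ 2 * Real.exp (-(((n + 1 : ℕ) : ℝ) * (((n + 1 : ℕ) : ℝ) + 2) / 2) * t)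
      ≤ q ^ (n + 1) := by
    intro n
    have hsq : ((n + 1 : ℕ) + 1 : ℝ) ^ 2 ≤ (4 : ℝ) ^ (n + 1) := by
      have : ∀ k : ℕ, ((k : ℝ) + 2) ^ 2 ≤ (4 : ℝ) ^ (k + 1) := by
        intro k
        induction k with
        | zero => norm_num
        | succ k ih =>
          push_cast
          rw [show (4 : ℝ) ^ (k + 1 + 1) = 4 ^ (k + 1) * 4 from pow_succ 4 (k + 1)]
          nlinarith [ih, sq_nonneg (k : ℝ), (k.cast_nonneg : (0 : ℝ) ≤ k)]
      have h := this n
      push_cast at h ⊢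
      nlinarith [h]
    have hexp : Real.exp (-(((n + 1 : ℕ) : ℝ) * (((n + 1 : ℕ) : ℝ) + 2) / 2) * t) ≤ Real.exp (-3) ^ (n + 1) := by
      rw [← Real.exp_nat_mul, Real.exp_le_exp]
      have hn : (1 : ℝ) ≤ ((n + 1 : ℕ) : ℝ) := by exact_mod_cast Nat.succ_le_succ (Nat.zero_le n)
      have hA : 0 ≤ (((n + 1 : ℕ) : ℝ)) * (((n + 1 : ℕ) : ℝ) + 2) := by positivity
      have h1 : (((n + 1 : ℕ) : ℝ)) * (((n + 1 : ℕ) : ℝ) + 2) / 2 * t ≥ (((n + 1 : ℕ) : ℝ)) * (((n + 1 : ℕ) : ℝ) + 2) := by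
        nlinarith [hA, ht]
      have h2 : (((n + 1 : ℕ) : ℝ)) * (((n + 1 : ℕ) : ℝ) + 2) ≥ 3 * ((n + 1 : ℕ) : ℝ) := by nlinarith [hn]
      push_cast at h1 h2 ⊢
      linarith
    calc ((n + 1 : ℕ) + 1 : ℝ) ^ 2 * Real.exp (-(((n + 1 : ℕ) : ℝ) * (((n + 1 : ℕ) : ℝ) + 2) / 2) * t)
        ≤ (4 : ℝ) ^ (n + 1) * Real.exp (-3) ^ (n + 1) :=
          mul_le_mul hsq hexp (Real.exp_pos _).le (by positivity)
      _ = q ^ (n + 1) := by rw [hq, mul_pow]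
  have hgeo : Summable fun n : ℕ => q ^ (n + 1) :=
    (summable_geometric_of_lt_one hq0 (by linarith)).comp_injective (add_left_injective 1)
  have hle := Summable.tsum_le_tsum hterm (Summable.of_nonneg_of_le (fun n => by positivity) hterm hgeo) hgeo
  refine hle.trans ?_
  have hsum : ∑' n : ℕ, q ^ (n + 1) = q / (1 - q) := by
    rw [show (fun n : ℕ => q ^ (n + 1)) = fun n => q * q ^ n from funext fun n => by ring, tsum_mul_left,
      tsum_geometric_of_lt_one hq0 (by linarith)]
    ring
  rw [hsum, div_le_iff₀ (by linarith)]
  linarith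

/-- **`h_t ≥ 1/2` on `SU(2)` for `t ≥ 2`.** [folklore] -/
theorem half_le_heatKernelSU2 {t : ℝ} (ht : 2 ≤ t) (U : Matrix.specialUnitaryGroup (Fin 2) ℂ) :
    1 / 2 ≤ ∑' n : ℕ, ((n : ℝ) + 1) * Real.exp (-((n : ℝ) * ((n : ℝ) + 2) / 2) * t) * su2Char n U := by
  have ht0 : 0 < t := by linarith
  have hs := summable_heatKernelSU2 ht0 U
  rw [hs.tsum_eq_zero_add]
  simp only [Nat.cast_zero, zero_add, zero_mul, zero_div, neg_zero, Real.exp_zero, mul_one, su2Char_zero_apply]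
  -- the tail is bounded in absolute value by the majorant tail
  have hs' := (summable_nat_add_iff 1).2 hs
  have hmaj' := (summable_nat_add_iff 1).2 (summable_heatKernelSU2_majorant ht0)
  have h1 := norm_tsum_le_tsum_norm hs'.norm
  have h2 := Summable.tsum_le_tsum (fun n => norm_heatKernelSU2_term_le t (n + 1) U) hs'.norm hmaj'
  have h3 := tsum_heatKernelSU2_majorant_tail_le ht
  rw [Real.norm_eq_abs] at h1
  have habs := (h1.trans h2).trans h3
  have := neg_abs_le (∑' n : ℕ, (((n + 1 : ℕ) : ℝ) + 1) * Real.exp (-(((n + 1 : ℕ) : ℝ) * (((n + 1 : ℕ) : ℝ) + 2) / 2) * t) *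
      su2Char (n + 1) U)
  push_cast at this habs ⊢
  linarith

/-! ### The Haar pairing of the heat kernel with translated characters -/

/-- **`∫ χ_m(V g⁻¹) h_t(V z⁻¹) dV = e^{-m(m+2)t/2} χ_m(z g⁻¹)`** for the Haar probability measure of `SU(2)`: the
character convolution identity `∫ χ_m(V) χ_n(V⁻¹U) dV = δ_{mn} χ_n(U)/(n+1)` term by term. [folklore] -/
theorem integral_su2Char_mul_heatKernelSU2 {t : ℝ} (ht : 0 < t) (m : ℕ) (g z : Matrix.specialUnitaryGroup (Fin 2) ℂ) :
    ∫ V, su2Char m (V * g⁻¹) *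
        (∑' n : ℕ, ((n : ℝ) + 1) * Real.exp (-((n : ℝ) * ((n : ℝ) + 2) / 2) * t) * su2Char n (V * z⁻¹))
        ∂(haarProbability (Matrix.specialUnitaryGroup (Fin 2) ℂ)) =
      Real.exp (-((m : ℝ) * ((m : ℝ) + 2) / 2) * t) * su2Char m (z * g⁻¹) := by
  haveI : IsProbabilityMeasure (haarProbability (Matrix.specialUnitaryGroup (Fin 2) ℂ)) := inferInstance
  haveI := YM2.isMulRightInvariant_haarProbability (Matrix.specialUnitaryGroup (Fin 2) ℂ)
  -- pull the character inside the series and exchange sum and integral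
  simp_rw [← tsum_mul_left]
  have hterm_cont : ∀ n : ℕ, Continuous fun V : Matrix.specialUnitaryGroup (Fin 2) ℂ =>
      su2Char m (V * g⁻¹) * (((n : ℝ) + 1) * Real.exp (-((n : ℝ) * ((n : ℝ) + 2) / 2) * t) * su2Char n (V * z⁻¹)) :=
    fun n => ((continuous_su2Char_apply m).comp (continuous_mul_const _)).mul
      (continuous_const.mul ((continuous_su2Char_apply n).comp (continuous_mul_const _)))
  have hbound : ∀ (n : ℕ) (V : Matrix.specialUnitaryGroup (Fin 2) ℂ),
      ‖su2Char m (V * g⁻¹) * (((n : ℝ) + 1) * Real.exp (-((n : ℝ) * ((n : ℝ) + 2) / 2) * t) * su2Char n (V * z⁻¹))‖ ≤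
        ((m : ℝ) + 1) * (((n : ℝ) + 1) ^ 2 * Real.exp (-((n : ℝ) * ((n : ℝ) + 2) / 2) * t)) := by
    intro n V
    rw [norm_mul]
    exact mul_le_mul ((Real.norm_eq_abs _).le.trans (abs_su2Char_le' m _)) (norm_heatKernelSU2_term_le t n _)
      (norm_nonneg _) (by positivity)
  have hint : ∀ n : ℕ, Integrable (fun V : Matrix.specialUnitaryGroup (Fin 2) ℂ =>
      su2Char m (V * g⁻¹) * (((n : ℝ) + 1) * Real.exp (-((n : ℝ) * ((n : ℝ) + 2) / 2) * t) * su2Char n (V * z⁻¹)))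
      (haarProbability (Matrix.specialUnitaryGroup (Fin 2) ℂ)) := fun n =>
    Integrable.of_bound (hterm_cont n).measurable.aestronglyMeasurable _ (Eventually.of_forall (hbound n))
  rw [← integral_tsum_of_summable_integral_norm hint]
  · -- term by term
    have hterm : ∀ n : ℕ, ∫ V, su2Char m (V * g⁻¹) *
        (((n : ℝ) + 1) * Real.exp (-((n : ℝ) * ((n : ℝ) + 2) / 2) * t) * su2Char n (V * z⁻¹))
        ∂(haarProbability (Matrix.specialUnitaryGroup (Fin 2) ℂ)) =
        if m = n then Real.exp (-((m : ℝ) * ((m : ℝ) + 2) / 2) * t) * su2Char m (z * g⁻¹) else 0 := by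
      intro n
      have hconv := Tomboulis2007.SU2SymPow.integral_su2Char_mul_su2Char_inv_mul m n (z * g⁻¹)
      -- `∫ χ_m(V g⁻¹) χ_n(V z⁻¹) dV = ∫ χ_m(V) χ_n(V⁻¹ (z g⁻¹)) dV` by `V ↦ V g`
      have hsub : ∫ V, su2Char m (V * g⁻¹) * su2Char n (V * z⁻¹) ∂(haarProbability (Matrix.specialUnitaryGroup (Fin 2) ℂ)) =
          ∫ V, su2Char m V * su2Char n (V⁻¹ * (z * g⁻¹)) ∂(haarProbability (Matrix.specialUnitaryGroup (Fin 2) ℂ)) := by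
        rw [← integral_mul_right_eq_self (fun V => su2Char m (V * g⁻¹) * su2Char n (V * z⁻¹)) g]
        refine integral_congr_ae (Eventually.of_forall fun V => ?_)
        simp only [mul_inv_cancel_right]
        congr 1
        rw [← su2Char_inv n (V * g * z⁻¹), mul_inv_rev, mul_inv_rev, inv_inv, ← mul_assoc, su2Char_mul_comm]
      calc ∫ V, su2Char m (V * g⁻¹) * (((n : ℝ) + 1) * Real.exp (-((n : ℝ) * ((n : ℝ) + 2) / 2) * t) * su2Char n (V * z⁻¹))
            ∂(haarProbability (Matrix.specialUnitaryGroup (Fin 2) ℂ))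
          = ((n : ℝ) + 1) * Real.exp (-((n : ℝ) * ((n : ℝ) + 2) / 2) * t) *
              ∫ V, su2Char m (V * g⁻¹) * su2Char n (V * z⁻¹) ∂(haarProbability (Matrix.specialUnitaryGroup (Fin 2) ℂ)) := by
            rw [← integral_const_mul]
            exact integral_congr_ae (Eventually.of_forall fun V => by ring)
        _ = if m = n then Real.exp (-((m : ℝ) * ((m : ℝ) + 2) / 2) * t) * su2Char m (z * g⁻¹) else 0 := by
            rw [hsub, hconv]
            split_ifs with h
            · subst h; field_simp
            · rw [mul_zero]
    simp_rw [hterm]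
    rw [tsum_eq_single m]
    · rw [if_pos rfl]
    · intro i hi; rw [if_neg (Ne.symm hi)]
  · refine Summable.of_nonneg_of_le (fun n => integral_nonneg fun V => norm_nonneg _) (fun n => ?_)
      ((summable_heatKernelSU2_majorant ht).mul_left ((m : ℝ) + 1))
    have h := integral_mono_of_nonneg (μ := haarProbability (Matrix.specialUnitaryGroup (Fin 2) ℂ))
      (Eventually.of_forall fun V => norm_nonneg _) (integrable_const _) (Eventually.of_forall (hbound n))
    simpa using h

end Summit.QuantumFields.YangMills.Theorems.ColdStartUniversality

end
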